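import Summits.QuantumAdvantage.QuantumAdvantage.Theorems.CubicForrelationNearExactIsExactTwoModSixPrep

/-!
# Crux `CubicForrelation.NearExactIsExact` (stmt-QuantumAdvantage-14043) — two-sided analysis on `n = 6r` bits (general `r`):
  Parseval, budget, pairing, and the tower above the Ax level

Certificate seat `b2b-cforr-cert` (gen 6).  HONEST FRAMING: preparatory lemmas, uniform in `r`, for the theorem that on `n ≡ 0 (mod 6)` bits the
boundary value `1 − 2^{−⌊n/3⌋−1}` of the uniform one-sided rate (`isolation_rate`) is never attained — infinitely many finite-slice verdicts,
NOT summit progress (the rate tends to `1`; at `n = 18` the tree's digit-based bound `63/64` is already better than this boundary).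

With `m = 3r`, `W_g = 2^{2r}·u` (Ax), `s = (−1)^f`, `τ = u − 2^r s` (a bent `g` has `|u| = 2^r`):
* `zms_sum_u_sq`: `Σ u² = 2^{8r}`;  `zms_sum_su`: `Σ (−1)^f u = 2^{7r} Φ`;  `zms_budget`: `Σ (u − 2^r s)² = 2^{8r+1}(1 − Φ)`;
  `zms_pairing`: `Σ_y (−1)^g τ̂(y) = 2^{10r}(1 − Φ)`;
* `zms_high_levels`: for `r ≥ 2`, `W_g ∈ 2^{2r+1}ℤ` and `Φ ≥ 1 − 2^{−(2r+1)}` force `Φ = 1` (`tms_walk_from` with cost exponent `2r`).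

References: J. Ax (1964) / R. J. McEliece (1972); X.-D. Hou (1998); R. O'Donnell (2014) §3.3.  Everything below is proved from Mathlib and the
tree; axioms are the standard three.
-/

set_option linter.dupNamespace false -- D-0017: single-problem summit ⇒ `QuantumAdvantage.QuantumAdvantage` by design

noncomputable section

namespace Summit.QuantumAdvantage.QuantumAdvantage.Theorems.CubicForrelation.NearExactIsExact

open Finset
open Literature.Computability.QuantumComplexity
open Literature.Computability.QuantumComplexity.DerivativeWalsh (W)

/-- Parseval at the Ax level on `6r` bits: `W_g = 2^{2r}u ⇒ Σ_x u(x)² = 2^{8r}`. [folklore] -/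
theorem zms_sum_u_sq (r : ℕ) (g : (Fin (3 * r + 3 * r) → Bool) → Bool) (u : (Fin (3 * r + 3 * r) → Bool) → ℤ)
    (hu : ∀ x, W (fun y => signOf (g y)) x = (2 : ℝ) ^ (2 * r) * (u x : ℝ)) : ∑ x, ((u x : ℝ)) ^ 2 = (2 : ℝ) ^ (8 * r) := by
  have hP := DerivativeWalsh.sum_W_sq (fun y => signOf (g y))
  have h1 : ∀ b : Bool, signOf b ^ 2 = (1 : ℝ) := fun b => by unfold signOf; split_ifs <;> norm_num
  have hL : ∑ x, W (fun y => signOf (g y)) x ^ 2 = (2 : ℝ) ^ (4 * r) * ∑ x, (u x : ℝ) ^ 2 := by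
    rw [mul_sum]
    refine sum_congr rfl fun x _ => ?_
    rw [hu x]; ring
  rw [hL, sum_congr rfl fun y _ => h1 _, sum_const, card_univ, Fintype.card_fun, Fintype.card_bool, Fintype.card_fin,
    nsmul_eq_mul, mul_one] at hP
  push_cast at hP
  have e : ((2 : ℝ) ^ (3 * r + 3 * r)) * 2 ^ (3 * r + 3 * r) = 2 ^ (4 * r) * 2 ^ (8 * r) := by ring
  rw [e] at hP
  exact mul_left_cancel₀ (by positivity) hP

/-- `Σ_x (−1)^{f(x)} u(x) = 2^{7r}·Φ(f,g)` on `6r` bits with `W_g = 2^{2r}u`. [folklore] -/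
theorem zms_sum_su (r : ℕ) (f g : (Fin (3 * r + 3 * r) → Bool) → Bool) (u : (Fin (3 * r + 3 * r) → Bool) → ℤ)
    (hu : ∀ x, W (fun y => signOf (g y)) x = (2 : ℝ) ^ (2 * r) * (u x : ℝ)) :
    ∑ x, signOf (f x) * (u x : ℝ) = (2 : ℝ) ^ (7 * r) * forrelation f g := by
  have hΦ := vg_two_pow_mul_forrelation f g
  have e : ∑ x, signOf (f x) * W (fun y => signOf (g y)) x = (2 : ℝ) ^ (2 * r) * ∑ x, signOf (f x) * (u x : ℝ) := by
    rw [mul_sum]; exact sum_congr rfl fun x _ => by rw [hu x]; ring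
  rw [e, show 3 * (3 * r) = 2 * r + 7 * r by ring, pow_add, mul_assoc] at hΦ
  exact (mul_left_cancel₀ (by positivity) hΦ).symm

/-- **Two-sided budget on `6r` bits.** `Σ_x (u − 2^r s)² = 2^{8r+1}·(1 − Φ(f,g))`. [this work] -/
theorem zms_budget (r : ℕ) (f g : (Fin (3 * r + 3 * r) → Bool) → Bool) (u : (Fin (3 * r + 3 * r) → Bool) → ℤ)
    (hu : ∀ x, W (fun y => signOf (g y)) x = (2 : ℝ) ^ (2 * r) * (u x : ℝ)) :
    ((∑ x, (u x - 2 ^ r * sZ (f x)) ^ 2 : ℤ) : ℝ) = (2 : ℝ) ^ (8 * r + 1) * (1 - forrelation f g) := by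
  have hsq := zms_sum_u_sq r g u hu
  have hsu := zms_sum_su r f g u hu
  have hL : ((∑ x, (u x - 2 ^ r * sZ (f x)) ^ 2 : ℤ) : ℝ) =
      ∑ x, ((u x : ℝ) ^ 2 - 2 * 2 ^ r * (signOf (f x) * (u x : ℝ)) + ((2 : ℝ) ^ r) ^ 2) := by
    push_cast
    refine sum_congr rfl fun x _ => ?_
    rw [tp_sZ_cast]
    linear_combination ((2 : ℝ) ^ r) ^ 2 * BuzetChailloux.signOf_sq (f x)
  rw [hL, sum_add_distrib, sum_sub_distrib, ← mul_sum, hsq, hsu, sum_const, card_univ, Fintype.card_fun, Fintype.card_bool,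
    Fintype.card_fin, nsmul_eq_mul]
  push_cast
  ring

/-- **The two-sided pairing identity on `6r` bits.** `Σ_y (−1)^{g(y)}·(u − 2^r(−1)^f)^(y) = 2^{10r}·(1 − Φ(f,g))`. [this work] -/
theorem zms_pairing (r : ℕ) (f g : (Fin (3 * r + 3 * r) → Bool) → Bool) (u : (Fin (3 * r + 3 * r) → Bool) → ℤ)
    (hu : ∀ x, W (fun y => signOf (g y)) x = (2 : ℝ) ^ (2 * r) * (u x : ℝ)) :
    ∑ y, signOf (g y) * W (fun x => (u x : ℝ) - (2 : ℝ) ^ r * signOf (f x)) y = (2 : ℝ) ^ (10 * r) * (1 - forrelation f g) := by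
  rw [fl1_pairing]
  have hsq := zms_sum_u_sq r g u hu
  have hsu := zms_sum_su r f g u hu
  have e : ∀ x, ((u x : ℝ) - (2 : ℝ) ^ r * signOf (f x)) * W (fun y => signOf (g y)) x =
      (2 : ℝ) ^ (2 * r) * (u x : ℝ) ^ 2 - 2 ^ (2 * r) * 2 ^ r * (signOf (f x) * (u x : ℝ)) := by
    intro x; rw [hu x]; ring
  rw [sum_congr rfl fun x _ => e x, sum_sub_distrib, ← mul_sum, ← mul_sum, hsq, hsu]
  ring

/-- **The levels above the Ax level on `6r` bits (`r ≥ 2`).**  If `W_g ∈ 2^{2r+1}ℤ` and `Φ(f,g) ≥ 1 − 2^{−(2r+1)}` then `Φ(f,g) = 1`: every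
level `≥ 2r+1` of the tower costs at least `2^{−2r}`, and a bent `g` gives `Φ = 1` or `Φ ≤ 1 − 2^{1−⌊(3r+3)/2⌋} < 1 − 2^{−(2r+1)}`. [this work] -/
theorem zms_high_levels (r : ℕ) (hr : 2 ≤ r) (f g : (Fin (3 * r + 3 * r) → Bool) → Bool) (hf : IsDegLeFun 3 f)
    (hg : IsDegLeFun 3 g) (w : (Fin (3 * r + 3 * r) → Bool) → ℤ)
    (hw : ∀ x, W (fun y => signOf (g y)) x = (2 : ℝ) ^ (2 * r + 1) * (w x : ℝ))
    (hΦ : 1 - (1 / 2 : ℝ) ^ (2 * r + 1) ≤ forrelation f g) : forrelation f g = 1 := by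
  rcases tms_walk_from (3 * r) (2 * r + 1) (2 * r) g hg (by omega) (by omega) w hw (by intro j hj hjm; omega) (by omega)
    with hbent | hcap
  · rcases tw_bent_end (by omega) f g hf hg hbent with h | h
    · exact h
    · exfalso
      have hlt : (1 / 2 : ℝ) ^ (2 * r + 1) < 2 / 2 ^ ((3 * r + 3) / 2) := by
        have e : (2 : ℝ) / 2 ^ ((3 * r + 3) / 2) = (1 / 2) ^ ((3 * r + 3) / 2 - 1) := by
          obtain ⟨a, ha⟩ : ∃ a, (3 * r + 3) / 2 = a + 1 := ⟨(3 * r + 3) / 2 - 1, by omega⟩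
          rw [ha, pow_succ, one_div_pow, Nat.add_sub_cancel]
          field_simp
        rw [e]
        exact pow_lt_pow_right_of_lt_one₀ (by norm_num) (by norm_num) (by omega)
      linarith
  · exfalso
    have := tw_forrelation_le_of_cap f g hcap
    have hlt : (1 / 2 : ℝ) ^ (2 * r + 1) < (1 / 2) ^ (2 * r) := pow_lt_pow_right_of_lt_one₀ (by norm_num) (by norm_num) (by omega)
    linarith

end Summit.QuantumAdvantage.QuantumAdvantage.Theorems.CubicForrelation.NearExactIsExact

end
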